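import Summits.Ventures.PercRepro.S1FourLinesOnEight

/-!
# PercRepro — THE RANK PROFILE OF A COLOOP-FREE SIMPLE RANK-5 MATROID ON 8 POINTS BY SIZES (p2, gen 28;
SUBCLAIM-S1 §6.10 (xvii)(p); towards the last `(8, 6)` shape)

Closures of pairs have `≤ 4` points, so a rank-`n` set has `≤ n + 2` points. `f(2) ≥ 28 + t + q₂`,
`f(3) ≥ 56 − t + q₃ + r₅₃`, `f(4) ≥ u₄ + r₅₄ + r₆₄`, `f(5) ≥ 9 + s₅ + s₆` (`rkSets`), the partitions of the `4`-, `5`-,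
`6`-sets by rank, the complements `N(5, 3) + t ≤ 56`, `N(5, 2) ≤ t + s₆`, and the kill bound `t + s₅ ≤ 56` (the
extension incidence twice). Nothing is claimed about any cell.

* `eRk_bounds_rank_five_eight`, `mem_rank_classes_eight`, `choose_le_rank_classes_eight`, `rkSets_eq_empty_of_big_eight`,
  `rankTwoSets_eq_empty_of_big_eight`, `profile_rank_five_eight`, `partitions_rank_five_eight`,
  `complements_rank_five_eight`, `kill_bound_rank_five_eight`.
Axioms: standard.
-/

open scoped Matroid

namespace PercRepro

namespace S1

open Set

variable {α : Type}

section RankFiveOnEight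

variable {N : Matroid α} [N.Finite]

/-- The rank of a `k`-set as a natural with its bounds, on `8` points of rank `5`. -/
theorem eRk_bounds_rank_five_eight (hN : N.eRank = ((5 : ℕ) : ℕ∞)) (hE : N.E.ncard = 8) (hcol : N.coloops = ∅)
    (hpairs : ∀ e ∈ N.E, ∀ f ∈ N.E, e ≠ f → N.eRk {e, f} = 2) {X : Set α} (hX : X ⊆ N.E) (h2 : 2 ≤ X.ncard) :
    ∃ n : ℕ, N.eRk X = (n : ℕ∞) ∧ 2 ≤ n ∧ n ≤ 5 ∧ n ≤ X.ncard ∧ (n < 5 → X.ncard + (5 - n + 1) ≤ 8) := by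
  have hhi : N.eRk X ≤ N.eRank := N.eRk_le_eRank X
  rw [hN] at hhi
  obtain ⟨n, hn⟩ := ENat.ne_top_iff_exists.mp (ne_top_of_le_ne_top (by decide) hhi)
  have hlo := two_le_eRk_of_two_le_ncard hpairs hX h2
  have hsize : N.eRk X ≤ (X.ncard : ℕ∞) := by
    have := N.eRk_le_encard X
    rwa [← (N.ground_finite.subset hX).cast_ncard_eq] at this
  rw [← hn] at hlo hhi hsize
  refine ⟨n, hn.symm, by exact_mod_cast hlo, by exact_mod_cast hhi, by exact_mod_cast hsize, fun h => ?_⟩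
  have hmiss := sub_add_one_le_ncard_ground_sdiff_of_coloops N hN hcol hX hn.symm h
  rw [ncard_sdiff' hX N.ground_finite, hE] at hmiss
  have := ncard_le_ncard hX N.ground_finite
  rw [hE] at this
  omega

/-- A `k`-set (`k ≥ 2`) lies in one of the four rank classes. -/
theorem mem_rank_classes_eight (hN : N.eRank = ((5 : ℕ) : ℕ∞)) (hE : N.E.ncard = 8) (hcol : N.coloops = ∅)
    (hpairs : ∀ e ∈ N.E, ∀ f ∈ N.E, e ≠ f → N.eRk {e, f} = 2) {X : Set α} (hX : X ⊆ N.E) (h2 : 2 ≤ X.ncard) :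
    X ∈ rankTwoSets N X.ncard ∪ rkSets N X.ncard 3 ∪ rkSets N X.ncard 4 ∪ rkSets N X.ncard 5 := by
  obtain ⟨n, hn, hn2, hn5, -, -⟩ := eRk_bounds_rank_five_eight hN hE hcol hpairs hX h2
  rcases Nat.lt_or_ge n 3 with h | h
  · left; left; left; refine ⟨hX, rfl, ?_⟩; rw [hn]; have : n = 2 := by omega
    rw [this]; rfl
  rcases Nat.lt_or_ge n 4 with h' | h'
  · left; left; right; refine ⟨hX, rfl, ?_⟩; rw [hn]; have : n = 3 := by omega
    rw [this]
  rcases Nat.lt_or_ge n 5 with h'' | h''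
  · left; right; refine ⟨hX, rfl, ?_⟩; rw [hn]; have : n = 4 := by omega
    rw [this]
  · right; refine ⟨hX, rfl, ?_⟩; rw [hn]; have : n = 5 := by omega
    rw [this]

/-- The `k`-sets are covered by the four rank classes. -/
theorem choose_le_rank_classes_eight (hN : N.eRank = ((5 : ℕ) : ℕ∞)) (hE : N.E.ncard = 8) (hcol : N.coloops = ∅)
    (hpairs : ∀ e ∈ N.E, ∀ f ∈ N.E, e ≠ f → N.eRk {e, f} = 2) (k : ℕ) (hk : 2 ≤ k) :
    Nat.choose 8 k ≤ (rankTwoSets N k).ncard + (rkSets N k 3).ncard + (rkSets N k 4).ncard + (rkSets N k 5).ncard := by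
  have hsub : {A : Set α | A ⊆ N.E ∧ A.ncard = k} ⊆
      rankTwoSets N k ∪ rkSets N k 3 ∪ rkSets N k 4 ∪ rkSets N k 5 := by
    rintro A ⟨hAE, hAk⟩
    have := mem_rank_classes_eight hN hE hcol hpairs hAE (by omega)
    rwa [hAk] at this
  have h := ncard_le_ncard hsub (((rankTwoSets_finite N k).union (rkSets_finite k 3)).union (rkSets_finite k 4) |>.union
    (rkSets_finite k 5))
  rw [ncard_setOf_subset_ncard_eq N.ground_finite k, hE] at h
  refine h.trans ((ncard_union_le _ _).trans ?_)
  exact Nat.add_le_add_right ((ncard_union_le _ _).trans (Nat.add_le_add_right (ncard_union_le _ _) _)) _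

/-- A rank-`n` set (`n < 5`) has at most `n + 2` points. -/
theorem rkSets_eq_empty_of_big_eight (hN : N.eRank = ((5 : ℕ) : ℕ∞)) (hE : N.E.ncard = 8) (hcol : N.coloops = ∅)
    {k n : ℕ} (hn : n < 5) (hk : 8 < k + (5 - n + 1)) : rkSets N k n = ∅ := by
  rw [eq_empty_iff_forall_notMem]
  rintro X ⟨hXE, hXk, hXn⟩
  have hmiss := sub_add_one_le_ncard_ground_sdiff_of_coloops N hN hcol hXE hXn hn
  rw [ncard_sdiff' hXE N.ground_finite, hE, hXk] at hmiss
  have := ncard_le_ncard hXE N.ground_finite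
  rw [hE] at this
  omega

/-- No rank-`2` set has more than `4` points. -/
theorem rankTwoSets_eq_empty_of_big_eight (hN : N.eRank = ((5 : ℕ) : ℕ∞)) (hE : N.E.ncard = 8) (hcol : N.coloops = ∅)
    {k : ℕ} (hk : 4 < k) : rankTwoSets N k = ∅ := by
  rw [eq_empty_iff_forall_notMem]
  rintro X ⟨hXE, hXk, hX2⟩
  have hX2' : N.eRk X = ((2 : ℕ) : ℕ∞) := hX2
  have hmiss := sub_add_one_le_ncard_ground_sdiff_of_coloops N hN hcol hXE hX2' (by norm_num)
  rw [ncard_sdiff' hXE N.ground_finite, hE, hXk] at hmiss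
  have := ncard_le_ncard hXE N.ground_finite
  rw [hE] at this
  omega

/-- `f(2) ≥ 28 + t + q₂`, `f(3) ≥ 56 − t + q₃ + r₅₃`, `f(4) ≥ u₄ + r₅₄ + r₆₄`, `f(5) ≥ 9 + s₅ + s₆`. -/
theorem profile_rank_five_eight (hN : N.eRank = ((5 : ℕ) : ℕ∞)) (hE : N.E.ncard = 8) (hcol : N.coloops = ∅)
    (hpairs : ∀ e ∈ N.E, ∀ f ∈ N.E, e ≠ f → N.eRk {e, f} = 2) :
    28 + (rankTwoSets N 3).ncard + (rankTwoSets N 4).ncard ≤ (rankSet N 2).ncard ∧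
    (56 - (rankTwoSets N 3).ncard) + (rkSets N 4 3).ncard + (rkSets N 5 3).ncard ≤ (rankSet N 3).ncard ∧
    (rkSets N 4 4).ncard + (rkSets N 5 4).ncard + (rkSets N 6 4).ncard ≤ (rankSet N 4).ncard ∧
    9 + (rkSets N 5 5).ncard + (rkSets N 6 5).ncard ≤ (rankSet N 5).ncard := by
  have hf : ∀ k : ℕ, {A : Set α | A ⊆ N.E ∧ A.ncard = k}.Finite := fun k =>
    N.ground_finite.finite_subsets.subset (fun _ hA => hA.1)
  refine ⟨?_, ?_, ?_, ?_⟩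
  · have hsub : {A : Set α | A ⊆ N.E ∧ A.ncard = 2} ∪ rankTwoSets N 3 ∪ rankTwoSets N 4 ⊆ rankSet N 2 := by
      rintro A ((⟨hAE, h2⟩ | ⟨hAE, -, h⟩) | ⟨hAE, -, h⟩)
      · refine ⟨hAE, ?_⟩
        obtain ⟨x, y, hxy, rfl⟩ := ncard_eq_two.mp h2
        rw [hpairs x (hAE (by simp)) y (hAE (by simp)) hxy]; rfl
      · exact ⟨hAE, h⟩
      · exact ⟨hAE, h⟩
    have h := ncard_le_ncard hsub (rankSet_finite N 2)
    rw [ncard_union_eq (by rw [Set.disjoint_left]; rintro A (⟨-, h2⟩ | ⟨-, h3, -⟩) ⟨-, h4, -⟩ <;> omega)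
        ((hf 2).union (rankTwoSets_finite N 3)) (rankTwoSets_finite N 4),
      ncard_union_eq (by rw [Set.disjoint_left]; rintro A ⟨-, h2⟩ ⟨-, h3, -⟩; omega) (hf 2) (rankTwoSets_finite N 3),
      ncard_setOf_subset_ncard_eq N.ground_finite 2, hE, show Nat.choose 8 2 = 28 by decide] at h
    exact h
  · have h3 : (rkSets N 3 3).ncard + (rankTwoSets N 3).ncard ≥ 56 := by
      have := choose_le_rank_classes_eight hN hE hcol hpairs 3 (by norm_num)
      rw [rkSets_eq_empty_of_lt (M := N) (k := 3) (n := 4) (by norm_num),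
        rkSets_eq_empty_of_lt (M := N) (k := 3) (n := 5) (by norm_num), ncard_empty,
        show Nat.choose 8 3 = 56 by decide] at this
      omega
    have hsub : rkSets N 3 3 ∪ rkSets N 4 3 ∪ rkSets N 5 3 ⊆ rankSet N 3 := by
      rintro A ((hA | hA) | hA) <;> exact rkSets_subset_rankSet _ _ hA
    have h := ncard_le_ncard hsub (rankSet_finite N 3)
    rw [ncard_union_eq (by rw [Set.disjoint_left]; rintro A (⟨-, h3', -⟩ | ⟨-, h4', -⟩) ⟨-, h5', -⟩ <;> omega)
        ((rkSets_finite 3 3).union (rkSets_finite 4 3)) (rkSets_finite 5 3),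
      ncard_union_eq (by rw [Set.disjoint_left]; rintro A ⟨-, h3', -⟩ ⟨-, h4', -⟩; omega) (rkSets_finite 3 3)
        (rkSets_finite 4 3)] at h
    omega
  · have hsub : rkSets N 4 4 ∪ rkSets N 5 4 ∪ rkSets N 6 4 ⊆ rankSet N 4 := by
      rintro A ((hA | hA) | hA) <;> exact rkSets_subset_rankSet _ _ hA
    have h := ncard_le_ncard hsub (rankSet_finite N 4)
    rw [ncard_union_eq (by rw [Set.disjoint_left]; rintro A (⟨-, h4', -⟩ | ⟨-, h5', -⟩) ⟨-, h6', -⟩ <;> omega)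
        ((rkSets_finite 4 4).union (rkSets_finite 5 4)) (rkSets_finite 6 4),
      ncard_union_eq (by rw [Set.disjoint_left]; rintro A ⟨-, h4', -⟩ ⟨-, h5', -⟩; omega) (rkSets_finite 4 4)
        (rkSets_finite 5 4)] at h
    exact h
  · have h7 : (rkSets N 7 5).ncard ≥ 8 := by
      have := choose_le_rank_classes_eight hN hE hcol hpairs 7 (by norm_num)
      rw [rankTwoSets_eq_empty_of_big_eight hN hE hcol (k := 7) (by norm_num),
        rkSets_eq_empty_of_big_eight hN hE hcol (k := 7) (n := 3) (by norm_num) (by norm_num),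
        rkSets_eq_empty_of_big_eight hN hE hcol (k := 7) (n := 4) (by norm_num) (by norm_num), ncard_empty,
        show Nat.choose 8 7 = 8 by decide] at this
      omega
    have hsub : {N.E} ∪ rkSets N 7 5 ∪ rkSets N 5 5 ∪ rkSets N 6 5 ⊆ rankSet N 5 := by
      rintro A (((hA | hA) | hA) | hA)
      · rw [mem_singleton_iff] at hA; subst hA
        exact ⟨subset_rfl, by rw [N.eRk_ground, hN]⟩
      all_goals exact rkSets_subset_rankSet _ _ hA
    have h := ncard_le_ncard hsub (rankSet_finite N 5)
    rw [ncard_union_eq (by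
          rw [Set.disjoint_left]
          rintro A ((hA | ⟨-, h7', -⟩) | ⟨-, h5', -⟩) ⟨-, h6', -⟩
          · rw [mem_singleton_iff] at hA; subst hA; omega
          all_goals omega) (((finite_singleton _).union (rkSets_finite 7 5)).union (rkSets_finite 5 5))
          (rkSets_finite 6 5),
      ncard_union_eq (by
          rw [Set.disjoint_left]
          rintro A (hA | ⟨-, h7', -⟩) ⟨-, h5', -⟩
          · rw [mem_singleton_iff] at hA; subst hA; omega
          · omega) ((finite_singleton _).union (rkSets_finite 7 5)) (rkSets_finite 5 5),
      ncard_union_eq (by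
          rw [Set.disjoint_left]
          rintro A hA ⟨-, h7', -⟩
          rw [mem_singleton_iff] at hA; subst hA; omega) (finite_singleton _) (rkSets_finite 7 5),
      ncard_singleton] at h
    omega

/-- The partitions of the `4`-, `5`-, `6`-sets by rank. -/
theorem partitions_rank_five_eight (hN : N.eRank = ((5 : ℕ) : ℕ∞)) (hE : N.E.ncard = 8) (hcol : N.coloops = ∅)
    (hpairs : ∀ e ∈ N.E, ∀ f ∈ N.E, e ≠ f → N.eRk {e, f} = 2) :
    70 ≤ (rankTwoSets N 4).ncard + (rkSets N 4 3).ncard + (rkSets N 4 4).ncard ∧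
    56 ≤ (rkSets N 5 3).ncard + (rkSets N 5 4).ncard + (rkSets N 5 5).ncard ∧
    28 ≤ (rkSets N 6 4).ncard + (rkSets N 6 5).ncard := by
  refine ⟨?_, ?_, ?_⟩
  · have := choose_le_rank_classes_eight hN hE hcol hpairs 4 (by norm_num)
    rw [rkSets_eq_empty_of_lt (M := N) (k := 4) (n := 5) (by norm_num), ncard_empty,
      show Nat.choose 8 4 = 70 by decide] at this
    omega
  · have := choose_le_rank_classes_eight hN hE hcol hpairs 5 (by norm_num)
    rw [rankTwoSets_eq_empty_of_big_eight hN hE hcol (k := 5) (by norm_num), ncard_empty,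
      show Nat.choose 8 5 = 56 by decide] at this
    omega
  · have := choose_le_rank_classes_eight hN hE hcol hpairs 6 (by norm_num)
    rw [rankTwoSets_eq_empty_of_big_eight hN hE hcol (k := 6) (by norm_num),
      rkSets_eq_empty_of_big_eight hN hE hcol (k := 6) (n := 3) (by norm_num) (by norm_num), ncard_empty,
      show Nat.choose 8 6 = 28 by decide] at this
    omega

/-- The complements: `N_N(5, 3) + t ≤ 56` and `N_N(5, 2) ≤ t + s₆`. -/
theorem complements_rank_five_eight (hE : N.E.ncard = 8) :
    (profileSet N 5 3).ncard + (rankTwoSets N 3).ncard ≤ 56 ∧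
    (profileSet N 5 2).ncard ≤ (rankTwoSets N 3).ncard + (rkSets N 6 5).ncard := by
  have hsizes : ∀ {k : ℕ} {A : Set α}, A ∈ profileSet N 5 k →
      5 ≤ A.ncard ∧ k ≤ (N.E \ A).ncard ∧ A.ncard + (N.E \ A).ncard = 8 := by
    rintro k A ⟨hAE, hA5, hAc⟩
    have hAfin : A.Finite := N.ground_finite.subset hAE
    have h1 : ((5 : ℕ) : ℕ∞) ≤ (A.ncard : ℕ∞) := by
      rw [← hA5, hAfin.cast_ncard_eq]; exact N.eRk_le_encard A
    have h2 : ((k : ℕ) : ℕ∞) ≤ ((N.E \ A).ncard : ℕ∞) := by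
      rw [← hAc, (N.ground_finite.subset sdiff_subset).cast_ncard_eq]; exact N.eRk_le_encard _
    have h3 : A.ncard + (N.E \ A).ncard = N.E.ncard := by
      rw [← ncard_union_eq disjoint_sdiff_right hAfin (N.ground_finite.subset sdiff_subset), union_sdiff_cancel hAE]
    exact ⟨by exact_mod_cast h1, by exact_mod_cast h2, by rw [h3, hE]⟩
  have hinj : ∀ k, InjOn (fun A => N.E \ A) (profileSet N 5 k) := by
    intro k A hA A' hA' hAA
    have e : N.E \ A = N.E \ A' := hAA
    have := congrArg (fun S => N.E \ S) e
    simp only [sdiff_sdiff_cancel_left hA.1, sdiff_sdiff_cancel_left hA'.1] at this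
    exact this
  have hf3 : {A : Set α | A ⊆ N.E ∧ A.ncard = 3}.Finite := N.ground_finite.finite_subsets.subset (fun _ hA => hA.1)
  have hTsub : rankTwoSets N 3 ⊆ {A : Set α | A ⊆ N.E ∧ A.ncard = 3} := fun T hT => ⟨hT.1, hT.2.1⟩
  refine ⟨?_, ?_⟩
  · have hsub : (fun A => N.E \ A) '' profileSet N 5 3 ⊆ {A : Set α | A ⊆ N.E ∧ A.ncard = 3} \ rankTwoSets N 3 := by
      rintro B ⟨A, hA, rfl⟩
      obtain ⟨h1, h2, h3⟩ := hsizes hA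
      refine ⟨⟨sdiff_subset, by show (N.E \ A).ncard = 3; omega⟩, fun hT => ?_⟩
      have := hT.2.2
      rw [hA.2.2] at this
      exact absurd this (by decide)
    have h := ncard_le_ncard hsub (hf3.subset sdiff_subset)
    rw [(hinj 3).ncard_image, ncard_sdiff hTsub (rankTwoSets_finite N 3), ncard_setOf_subset_ncard_eq N.ground_finite 3,
      hE, show Nat.choose 8 3 = 56 by decide] at h
    have hT : (rankTwoSets N 3).ncard ≤ 56 := by
      have := ncard_le_ncard hTsub hf3
      rwa [ncard_setOf_subset_ncard_eq N.ground_finite 3, hE, show Nat.choose 8 3 = 56 by decide] at this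
    omega
  · have hsub : profileSet N 5 2 ⊆ (fun T => N.E \ T) '' rankTwoSets N 3 ∪ rkSets N 6 5 := by
      intro A hA
      obtain ⟨h1, h2, h3⟩ := hsizes hA
      obtain ⟨hAE, hA5, hAc⟩ := hA
      rcases Nat.lt_or_ge A.ncard 6 with h | h
      · left; exact ⟨N.E \ A, ⟨sdiff_subset, by omega, hAc⟩, sdiff_sdiff_cancel_left hAE⟩
      · right; exact ⟨hAE, by omega, hA5⟩
    have h := ncard_le_ncard hsub (((rankTwoSets_finite N 3).image _).union (rkSets_finite 6 5))
    exact h.trans ((ncard_union_le _ _).trans (Nat.add_le_add_right (ncard_image_le (rankTwoSets_finite N 3)) _))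

/-- The kill bound `t + s₅ ≤ 56`: the extension incidence twice (`5 t ≤ 4 #low4`, `4 #low4 ≤ 5 #low5`). -/
theorem kill_bound_rank_five_eight (hE : N.E.ncard = 8) : (rankTwoSets N 3).ncard + (rkSets N 5 5).ncard ≤ 56 := by
  have h1 := sub_mul_ncard_lowRankSets_le N 3 2
  have h2 := sub_mul_ncard_lowRankSets_le N (3 + 1) (2 + 1)
  rw [hE] at h1 h2
  have ht : (rankTwoSets N 3).ncard ≤ (lowRankSets N 3 2).ncard :=
    ncard_le_ncard (fun T hT => ⟨hT.1, hT.2.1, by rw [hT.2.2]; norm_num⟩) (lowRankSets_finite N 3 2)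
  have h5 : (lowRankSets N (3 + 1 + 1) (2 + 1 + 1)).ncard + (rkSets N 5 5).ncard ≤ 56 := by
    have hf5 : {A : Set α | A ⊆ N.E ∧ A.ncard = 5}.Finite := N.ground_finite.finite_subsets.subset (fun _ hA => hA.1)
    have hsub : lowRankSets N (3 + 1 + 1) (2 + 1 + 1) ∪ rkSets N 5 5 ⊆ {A : Set α | A ⊆ N.E ∧ A.ncard = 5} := by
      rintro Q (⟨hQE, h5, -⟩ | ⟨hQE, h5, -⟩) <;> exact ⟨hQE, h5⟩
    have h := ncard_le_ncard hsub hf5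
    rwa [ncard_union_eq (by
        rw [Set.disjoint_left]
        rintro Q ⟨-, -, hle⟩ ⟨-, -, h5⟩
        rw [h5] at hle
        exact absurd hle (by decide)) (lowRankSets_finite N (3 + 1 + 1) (2 + 1 + 1)) (rkSets_finite 5 5),
      ncard_setOf_subset_ncard_eq N.ground_finite 5, hE, show Nat.choose 8 5 = 56 by decide] at h
  omega

end RankFiveOnEight

end S1

end PercRepro
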